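import Mathlib
import Summits.Ventures.HodgeRepro.Tier4.Line1.RTFSetting
import Summits.Ventures.HodgeRepro.Tier4.Line4.LatticeCount

/-!
# Tier4/Line4/LatticeVolume — the disjoint-translates bound `#(G(k) ∩ gK) · μ(U) ≤ μ(K · U)`

Blind re-derivation cell `pub-hodge-repro`, Tier 4 «prove the step» (README §9–§10), seat t4-L4-p2 (prover, LINE L4,
gen 4; offer C-L4-LATTICEVOL, S14950).  Tree path `lean/Summits/Ventures/HodgeRepro/Tier4/Line4/LatticeVolume.lean`.
Mathlib-level; no literature; no `def`.

`LatticeCount` bounds the number of rational points in a left translate `g K` of a compact set uniformly in `g`, by a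
covering number.  This module gives the VOLUME form of the same count: for a discrete subgroup `Γ = S.Gk` of `G` with a left
Haar measure `μ = S.μ`, there is an open `U ∋ 1` such that for every `g` and every finite set `F` of rational points of
`g K`, `#F · μ(U) ≤ μ(K · U)`.  Proof: choose `U` with `U U⁻¹ ∩ Γ = {1}` (`exists_isOpen_separating`); the translates
`(g⁻¹ γ) U`, `γ ∈ F`, are pairwise disjoint (`γ u = γ' u'` forces `γ = γ'`), measurable, of measure `μ(U)` each (left
invariance), and contained in `g⁻¹ · (K U)` hmm — in `g (K U)` read through `z ↦ g⁻¹ z`, whose measure is `μ(K U)`.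
No compactness is used; for a compact `K` and a relatively compact `U` both sides are finite.

WHY (display (8) of Skeleton-v0.33, `PoincareOfDecay`): the sublevel count `#{γ : x⁻¹ γ y ∈ B_T} ≤ C′ e^{αT}` that
`poincareSummable_of_decay` (t4-x2) consumes follows from this bound, the compact-shift lemma for `archDist`, and a bound on
the Haar VOLUME of the sublevel sets `B_T = {g : archDist g ≤ T}` — a statement about one explicit set and a Haar measure,
with no lattice in it.

Nothing here says anything about the status of the Hodge conjecture for CM abelian varieties, which is NOT proved
(HC_CM is NOT proved by anyone in this repository).
-/

set_option autoImplicit false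

noncomputable section

namespace Summit.Ventures.HodgeRepro.Tier4.Line4

open MeasureTheory Topology Filter Set Summit.Ventures.HodgeRepro.Tier4 Summit.Ventures.HodgeRepro.Tier4.Line1
  Summit.Ventures.HodgeRepro.Tier4.Line1.RTF

open scoped Pointwise ENNReal

variable {G : Type} [Group G] [TopologicalSpace G] [IsTopologicalGroup G] [MeasurableSpace G] [BorelSpace G]
  (S : Setting G)

omit [BorelSpace G] in
/-- **A separating neighbourhood of `1`**: an open `U ∋ 1` such that two rational points with `γ u = γ' u'`, `u, u' ∈ U`,
coincide (`U U⁻¹` meets `G(k)` in `1` only: `U = W ∩ W⁻¹` with `W W ⊆ V`, `V` isolating). -/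
theorem exists_isOpen_separating :
    ∃ U : Set G, IsOpen U ∧ (1 : G) ∈ U ∧
      ∀ γ γ' : S.Gk, ∀ u ∈ U, ∀ u' ∈ U, (γ : G) * u = γ' * u' → γ = γ' := by
  obtain ⟨V, hVo, hV1, hV⟩ := exists_isOpen_isolating_one S
  obtain ⟨W, hWo, hW1, hWW⟩ := exists_open_nhds_one_mul_subset (hVo.mem_nhds hV1)
  refine ⟨W ∩ W⁻¹, hWo.inter hWo.inv, ⟨hW1, by simpa using hW1⟩, ?_⟩
  intro γ γ' u hu u' hu' h
  have hmem : ((γ'⁻¹ * γ : S.Gk) : G) ∈ V := by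
    have heq : ((γ'⁻¹ * γ : S.Gk) : G) = u' * u⁻¹ := by
      show (γ' : G)⁻¹ * γ = u' * u⁻¹
      calc (γ' : G)⁻¹ * γ = (γ' : G)⁻¹ * ((γ : G) * u) * u⁻¹ := by group
        _ = (γ' : G)⁻¹ * ((γ' : G) * u') * u⁻¹ := by rw [h]
        _ = u' * u⁻¹ := by group
    rw [heq]
    exact hWW (Set.mul_mem_mul hu'.1 (Set.mem_inv.mp hu.2))
  exact (inv_mul_eq_one.mp (hV _ hmem)).symm

/-- **The disjoint-translates bound** for a separating open `U`: `#F · μ(U) ≤ μ(K · U)` for every `g ∈ G` and every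
finite set `F` of rational points of the translate `g K` — the translates `(g⁻¹ γ) U`, `γ ∈ F`, are pairwise disjoint
subsets of `K · U` (`g⁻¹ γ ∈ K`), each of measure `μ(U)` by left invariance. -/
theorem card_mul_measure_le_of_separating {U : Set G} (hUo : IsOpen U)
    (hU : ∀ γ γ' : S.Gk, ∀ u ∈ U, ∀ u' ∈ U, (γ : G) * u = γ' * u' → γ = γ') (K : Set G) (g : G)
    (F : Finset S.Gk) (hF : ∀ γ ∈ F, g⁻¹ * (γ : G) ∈ K) : (F.card : ℝ≥0∞) * S.μ U ≤ S.μ (K * U) := by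
  haveI := S.haar
  -- the translates, as preimages under left multiplication
  have hdisj : Set.PairwiseDisjoint (↑F : Set S.Gk)
      (fun γ : S.Gk => (fun z : G => (g⁻¹ * γ)⁻¹ * z) ⁻¹' U) := by
    intro γ _ γ' _ hne
    refine Set.disjoint_left.mpr fun z hz hz' => hne ?_
    refine hU γ γ' _ hz _ hz' ?_
    show (γ : G) * ((g⁻¹ * γ)⁻¹ * z) = γ' * ((g⁻¹ * γ')⁻¹ * z)
    group
  have hmeas : ∀ γ ∈ F, MeasurableSet ((fun z : G => (g⁻¹ * γ)⁻¹ * z) ⁻¹' U) :=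
    fun γ _ => hUo.measurableSet.preimage (measurable_const_mul _)
  have hsub : (⋃ γ ∈ F, (fun z : G => (g⁻¹ * γ)⁻¹ * z) ⁻¹' U) ⊆ K * U := by
    intro z hz
    rw [Set.mem_iUnion₂] at hz
    obtain ⟨γ, hγ, hzγ⟩ := hz
    have heq : z = (g⁻¹ * γ) * ((g⁻¹ * γ)⁻¹ * z) := by group
    rw [heq]
    exact Set.mul_mem_mul (hF γ hγ) hzγ
  calc (F.card : ℝ≥0∞) * S.μ U
      = ∑ γ ∈ F, S.μ ((fun z : G => (g⁻¹ * γ)⁻¹ * z) ⁻¹' U) := by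
        rw [Finset.sum_congr rfl fun γ _ => measure_preimage_mul S.μ _ U]
        simp [Finset.sum_const, nsmul_eq_mul]
    _ = S.μ (⋃ γ ∈ F, (fun z : G => (g⁻¹ * γ)⁻¹ * z) ⁻¹' U) := (measure_biUnion_finset hdisj hmeas).symm
    _ ≤ S.μ (K * U) := measure_mono hsub

/-- **The disjoint-translates bound, existential form**: an open `U ∋ 1` with `#F · μ(U) ≤ μ(K · U)` for every `K`, `g` and
finite set `F` of rational points of `g K`. -/
theorem exists_card_mul_measure_le :
    ∃ U : Set G, IsOpen U ∧ (1 : G) ∈ U ∧ ∀ (K : Set G) (g : G) (F : Finset S.Gk),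
      (∀ γ ∈ F, g⁻¹ * (γ : G) ∈ K) → (F.card : ℝ≥0∞) * S.μ U ≤ S.μ (K * U) := by
  obtain ⟨U, hUo, hU1, hU⟩ := exists_isOpen_separating S
  exact ⟨U, hUo, hU1, fun K g F hF => card_mul_measure_le_of_separating S hUo hU K g F hF⟩

omit [BorelSpace G] in
/-- In a locally compact group the separating `U` can be taken relatively compact. -/
theorem exists_isOpen_separating_isCompact_closure [LocallyCompactSpace G] :
    ∃ U : Set G, IsOpen U ∧ (1 : G) ∈ U ∧ IsCompact (closure U) ∧
      ∀ γ γ' : S.Gk, ∀ u ∈ U, ∀ u' ∈ U, (γ : G) * u = γ' * u' → γ = γ' := by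
  obtain ⟨U, hUo, hU1, hU⟩ := exists_isOpen_separating S
  obtain ⟨C, hC, hC1⟩ := exists_compact_mem_nhds (1 : G)
  refine ⟨U ∩ interior C, hUo.inter isOpen_interior, ⟨hU1, mem_interior_iff_mem_nhds.mpr hC1⟩,
    hC.closure_of_subset (Set.inter_subset_right.trans interior_subset), ?_⟩
  intro γ γ' u hu u' hu' h
  exact hU γ γ' u hu.1 u' hu'.1 h

/-- **The real-valued bound** `#F · μ(U) ≤ μ(K · U)` in `ℝ`, for `μ(K · U) < ∞`, with `μ(U) > 0`: in a locally compact
group, with `K` compact, a relatively compact separating `U`. -/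
theorem exists_card_mul_measureReal_le [LocallyCompactSpace G] {K : Set G} (hK : IsCompact K) :
    ∃ U : Set G, IsOpen U ∧ (1 : G) ∈ U ∧ 0 < S.μ.real U ∧ S.μ (K * U) ≠ ∞ ∧
      ∀ (g : G) (F : Finset S.Gk), (∀ γ ∈ F, g⁻¹ * (γ : G) ∈ K) →
        (F.card : ℝ) * S.μ.real U ≤ S.μ.real (K * U) := by
  obtain ⟨U, hUo, hU1, hUc, hU⟩ := exists_isOpen_separating_isCompact_closure S
  haveI := S.haar
  have hKU : S.μ (K * U) ≠ ∞ := by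
    refine ne_of_lt ((measure_mono (Set.mul_subset_mul_left subset_closure)).trans_lt ?_)
    exact (hK.mul hUc).measure_lt_top
  have hUfin : S.μ U ≠ ∞ := ne_of_lt ((measure_mono subset_closure).trans_lt hUc.measure_lt_top)
  refine ⟨U, hUo, hU1, ?_, hKU, fun g F hF => ?_⟩
  · rw [measureReal_def]
    exact ENNReal.toReal_pos (hUo.measure_pos S.μ ⟨1, hU1⟩).ne' hUfin
  · have h := card_mul_measure_le_of_separating S hUo hU K g F hF
    have h' := ENNReal.toReal_mono hKU h
    rw [ENNReal.toReal_mul, ENNReal.toReal_natCast] at h'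
    simpa [measureReal_def] using h'

end Summit.Ventures.HodgeRepro.Tier4.Line4

end
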